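import Summits.ResolutionOfSingularities.ResolutionOfSingularities.Theorems.DescentDescentPerfectToAllExhaustion
import Summits.ResolutionOfSingularities.ResolutionOfSingularities.Theorems.DescentDescentPerfectToAllPerfectCoreResidual
import HarnessLib

/-!
# `DescentPerfectToAll` (stmt-ResolutionOfSingularities-0549) — lens 4, generation 3:
# EFT-separable exhaustion is INVARIANT UNDER SEPARABLE EXTENSIONS (statements; proofs in the memo)

Unit `res-B-lens-4-g3` (planner). OURS; nothing here is a statement of any manuscript, nothing here proves
resolution of singularities in characteristic `p`, nothing here decides the crux. Companion memo with complete
paper proofs: `Cruxes/DescentPerfectToAll/SeparableInvarianceOfExhaustion.md`.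

* `ExhaustedAt p L S` — the tree's residual binder (`hasResolution_of_perfectRes_of_exhaustedByEssFiniteType`,
  hypothesis `hk`; `descentPerfectToAll_iff_residual`) at ONE set `S` (verbatim the gen-2 definition in
  `ObstructionLens4_NoSeparableEnvelope.lean`).
* `MacLaneSeparable p K` (`K ≤ L`) — the tree's separability clause for `L/K`.
* `InPerfectCore`, `perfectCore` — `⋂ₘ L^{p^m}`; `PIndep` — finite `p`-independence in the tree's monomial shape.
* `linearDisjoint_perfectCore_of_macLaneSeparable` (LD): along a separable extension `L/K`, `K` and the perfect
  core of `L` are linearly disjoint over the perfect core of `K` («no new perfect constants»).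
* `exhaustedAt_iff_exists_pIndep` (Lemma E): local exhaustion criterion — exhausted at `S` iff `S` is algebraic over
  `C_L(u)` for a finite `p`-independent `u`; `exhaustedAt_iff_of_pRankOne` (E₁): in `p`-rank one, iff
  `trdeg_{C_K}(S) ≤ 1`.
* `exhaustedAt_iff_of_macLaneSeparable` (THEOREM D): for `L/K` separable and finite `S ⊆ K`,
  `ExhaustedAt p K S ↔ ExhaustedAt p L S`.
* `not_macLaneSeparable_of_exhaustedAt` (D₁, proved from D): an over-field exhausted at `S` of a field residual at
  `S` is an inseparable extension — every «resolve upstairs, descend» line on 0549 descends through inseparable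
  base change (`Literature.Barriers.ResolutionOfSingularities.InseparableBaseChangeResolution`, Picover stmt-0554).
  `not_exhaustedAt_map_of_pIndepPreserving` (D₁′): ring-map form, as in gen-2's O1/O6.

Sorries: LD, E, E₁, D, D₁′ (paper proofs in the memo §2). Proved here: D₁ from D, monotonicity.
-/

set_option linter.dupNamespace false
set_option linter.unusedSectionVars false
set_option linter.unusedVariables false

namespace Summit.ResolutionOfSingularities.ResolutionOfSingularities.Cruxes.DescentPerfectToAll.SeparableInvariance

variable (p : ℕ) [Fact p.Prime]

/-- «`L` is EFT-separably exhausted at `S`» (tree binder at one set; gen-2 `ExhaustedAt`, verbatim). -/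
def ExhaustedAt (L : Type) [Field L] (S : Set L) : Prop :=
  ∃ (k₀ : Type) (_ : Field k₀) (_ : PerfectField k₀) (E : Subfield L) (_ : Algebra k₀ E),
    Algebra.EssFiniteType k₀ E ∧ S ⊆ E ∧
      ∀ u : Finset L, LinearIndepOn E _root_.id (↑u : Set L) →
        LinearIndepOn E (fun x : L => x ^ p) (↑u : Set L)

/-- Mac Lane separability of `L` over the subfield `K` (the tree's clause): `K`-linearly independent finite
families of `L` have `K`-linearly independent `p`-th powers. -/
def MacLaneSeparable {L : Type} [Field L] (K : Subfield L) : Prop :=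
  ∀ u : Finset L, LinearIndepOn K _root_.id (↑u : Set L) →
    LinearIndepOn K (fun x : L => x ^ p) (↑u : Set L)

/-- `c` lies in the perfect core `⋂ₘ L^{p^m}`. -/
def InPerfectCore (L : Type) [Field L] (c : L) : Prop := ∀ m : ℕ, ∃ d : L, d ^ p ^ m = c

/-- The perfect core of `L` as a subfield (the closure of `⋂ₘ L^{p^m}`, which is already a subfield;
cf. tree `exists_perfectCore`). -/
def perfectCore (L : Type) [Field L] : Subfield L := Subfield.closure {c : L | InPerfectCore p L c}

/-- Finite `p`-independence in the tree's monomial shape (`linearIndependent_frobenius_monomials`). -/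
def PIndep {L : Type} [Field L] {n : ℕ} (u : Fin n → L) : Prop :=
  ∀ e : (Fin n → Fin p) → L, (∑ α, (∏ i, u i ^ (α i : ℕ)) * e α ^ p) = 0 → ∀ α, e α = 0

variable {p}

/-- Shape lemma: exhaustion at a set is inherited by subsets. -/
theorem ExhaustedAt.mono {L : Type} [Field L] {S S' : Set L} (hS : S' ⊆ S)
    (h : ExhaustedAt p L S) : ExhaustedAt p L S' := by
  obtain ⟨k₀, hk₀, hk₀', E, hA, hE, hSE, hML⟩ := h
  exact ⟨k₀, hk₀, hk₀', E, hA, hE, hS.trans hSE, hML⟩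

/-! ## LD — no new perfect constants under separable extensions -/

/-- **Lemma LD.** If `L/K` is Mac Lane separable, then `K` and the perfect core of `L` are linearly disjoint over
the perfect core of `K`: a non-trivial linear relation among elements of `K` with coefficients in `⋂ₘ L^{p^m}` can be
replaced by a non-trivial relation with coefficients in `K ∩ ⋂ₘ K^{p^m}`. Proof (memo §2): the solution space
`W ≤ Kⁿ` of the relation is stable under level-`p^m` digit maps w.r.t. a `p`-basis of `K` (which stays
`p`-independent in `L`), hence its reduced row-echelon basis has entries in `⋂ₘ K^{p^m}`. [OURS; the separable
ALGEBRAIC case is Bourbaki, Algebra II, Ch. V, Exercise 8] -/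
theorem linearDisjoint_perfectCore_of_macLaneSeparable {L : Type} [Field L] [CharP L p] (K : Subfield L)
    (hKL : MacLaneSeparable p K) {n : ℕ} (x : Fin n → L) (hx : ∀ i, x i ∈ K)
    (c : Fin n → L) (hc : ∀ i, InPerfectCore p L (c i)) (hc0 : c ≠ 0) (hrel : ∑ i, c i * x i = 0) :
    ∃ lam : Fin n → L, (∀ i, lam i ∈ K ∧ ∀ m : ℕ, ∃ d ∈ K, d ^ p ^ m = lam i) ∧ lam ≠ 0 ∧
      ∑ i, lam i * x i = 0 := by
  sorry

/-! ## Lemma E — the local exhaustion criterion -/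

/-- **Lemma E (local criterion).** `L` is exhausted at the finite set `S` iff `S` is algebraic over `C_L(u)` for some
finite family `u` that is `p`-independent in `L` (`C_L` the perfect core). (`⇒`: a `p`-basis of the exhausting level
`E` is a separating transcendence basis over its perfect constants and stays `p`-independent in `L`; `⇐`:
`E := C_L(u, S)` has `p`-basis `u` by `algebraicIndependent_of_pIndependent_perfect`, so `L/E` is separable.)
Pointwise form of the tree's `exhaustedByEssFiniteType_iff_exists_pIndependent_of_perfectCore`. [OURS] -/
theorem exhaustedAt_iff_exists_pIndep {L : Type} [Field L] [CharP L p] (S : Finset L) :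
    ExhaustedAt p L (↑S : Set L) ↔ ∃ (n : ℕ) (u : Fin n → L), PIndep p u ∧
      ∀ s ∈ S, IsAlgebraic (Subfield.closure ((perfectCore p L : Set L) ∪ Set.range u)) s := by
  sorry

/-- **Corollary E₁ (`p`-rank one).** If `K = Kᵖ(t)` with `t ∉ Kᵖ`, then `K` is exhausted at `S` iff `S` is algebraic
over `C_K(v)` for a single non-`p`-th power `v` (iff `trdeg_{C_K}(S) ≤ 1`); e.g. `𝔽ₚ((t))` is residual at any two
algebraically independent series `{s, s'}`, with or without `t`. [OURS] -/
theorem exhaustedAt_iff_of_pRankOne {K : Type} [Field K] [CharP K p] (t : K)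
    (hK : ∀ x : K, ∃ d : Fin p → K, x = ∑ i : Fin p, t ^ (i : ℕ) * d i ^ p) (ht : ∀ y : K, y ^ p ≠ t)
    (S : Finset K) :
    ExhaustedAt p K (↑S : Set K) ↔ ∃ v : K, (∀ y : K, y ^ p ≠ v) ∧
      ∀ s ∈ S, IsAlgebraic (Subfield.closure ((perfectCore p K : Set K) ∪ {v})) s := by
  sorry

/-! ## Theorem D — separable invariance -/

/-- **Theorem D (separable invariance of exhaustion).** If `L/K` is Mac Lane separable and `S ⊆ K` is finite, then
`K` is EFT-separably exhausted at `S` iff `L` is. `⇐` is transitivity of separability; `⇒` (memo §2, steps 1–6):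
Lemma E in `L`, exchange to put a `p`-basis `t̄` of `Lᵖ(K ∩ A)` into the `p`-independent family, the `t̄`-digit hull
`H ∋ S` inside `K ∩ E` (uniqueness of `p`-expansions — separability of `L/K` enters here), then LD for `L/H` and a
transcendence-degree / finite-generation count. Valid in every `p`-rank (answers gen-2's Q-∞). [OURS] -/
theorem exhaustedAt_iff_of_macLaneSeparable {L : Type} [Field L] [CharP L p] (K : Subfield L)
    (hKL : MacLaneSeparable p K) (S : Finset K) :
    ExhaustedAt p K (↑S : Set K) ↔ ExhaustedAt p L ((fun x : K => (x : L)) '' (↑S : Set K)) := by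
  sorry

/-- **Corollary D₁ (the over-field door is inseparable).** If `K ≤ L` is residual at `S` and `L` is exhausted at
`S`, then `L/K` is NOT separable: some finite `p`-independent family of `K` becomes `p`-dependent in `L`. So every
over-field in which the tree's engine resolves `X_L` (field of definition of `X` inside `𝔽ₚ(S)`) is an inseparable
base change of `K` — the class `Literature.Barriers.ResolutionOfSingularities.InseparableBaseChangeResolution`
(Picover, stmt-0554). Proved from Theorem D. [OURS] -/
theorem not_macLaneSeparable_of_exhaustedAt {L : Type} [Field L] [CharP L p] (K : Subfield L)
    (S : Finset K) (hK : ¬ ExhaustedAt p K (↑S : Set K))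
    (hL : ExhaustedAt p L ((fun x : K => (x : L)) '' (↑S : Set K))) : ¬ MacLaneSeparable p K :=
  fun h => hK ((exhaustedAt_iff_of_macLaneSeparable K h S).mpr hL)

/-- **Corollary D₁′ (ring-map form, cf. gen-2 O1/O6).** If `ι : K →+* L` preserves `p`-independence of finite
families (⟺ `L/ιK` separable) and `K` is residual at `S`, then `L` is residual at `ι '' S`. [OURS] -/
theorem not_exhaustedAt_map_of_pIndepPreserving {K L : Type} [Field K] [Field L] [CharP K p] [CharP L p]
    (ι : K →+* L) (hι : ∀ (n : ℕ) (b : Fin n → K), PIndep p b → PIndep p (ι ∘ b))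
    (S : Finset K) (hK : ¬ ExhaustedAt p K (↑S : Set K)) :
    ¬ ExhaustedAt p L (ι '' (↑S : Set K)) := by
  sorry

end Summit.ResolutionOfSingularities.ResolutionOfSingularities.Cruxes.DescentPerfectToAll.SeparableInvariance
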